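import Summits.QuantumFields.YangMills.Theorems.BalabanUVNodesPortS1LZHalfReg
import Summits.QuantumFields.YangMills.Theorems.BalabanUVNodesPortS1LZdetRegL

/-!
# NODE O port PT-A — ★★★ THE BRICK IN ★★★ director-ym №633's EXACT SHAPE: `lzHalfReg_of_P0C_of_classP2_of_classP5Nest : (∀F, P0HolExtAtRecordGL F) → (∀F, ClassP2Reg F) →
# (∀F, ClassP5NestReg F) → ∀F, PortRecordLZHalfReg F` — v3.7's `stub_LZhalfReg` type from `stub_P0C`'s letter, the (P2)-class letter and the ONE carrier-free class letter; with the bridge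
# to the first-cut letters and ◆ C34 (t4)'s CONSISTENCY AT THE BASE POINT (the letter's `B = 0` instance derived from `P0CarrierClauses` (P5) at `0` and the unit cut pairs)

Cell `ym-nodeO-ideate`, porter seat PT-A-1 (gen 11); `--kind proof --supports stmt-QuantumFields-27930 --as helper`; count-neutral.  [I] = [Balaban1987RG1]; [16] = [Balaban1985UV3];
[15] = [Balaban1985Variational].

WHY.  The first-cut brick ✓`lzHalfReg_of_P0C_of_classP2` (✓`…PortS1LZHalfReg`) displays TWO extra letters (`ClassP5Reg`, (E2)-keyed through the P0C guard, and `ClassNestsUc`); ★★★ №633 (a)–(c)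
rules ONE carrier-free letter `ClassP5NestReg` (✓`…ClassRegDefs` §3).  This file re-runs the letter walk with it (the Gaussian half through ✓`lzdetResidueOnReg_of_carriers_classP5Nest`, radius
`R := max (2γ′) (16c₀·64K₀·e^{δ₀})`), adds the trivial bridge `ClassP5NestReg → ClassNestsUc`, and ◆ C34 (t4): the letter's body AT `B = 0` is a THEOREM from the P0-ℂ body alone
(`P0CarrierClauses` (P5) at the base point + `pairCutTorusAt … X 0 = (1, 0) ∈ U^c(X, α₀, α₁)`), so the new letter and the old ones agree where both speak.
* §1 `pairCutTorusAt_zero`, `cutsInUc_zero`, ★ `classP5NestBody_zero_of_P0C` ((t4)), `classNestsUc_of_classP5NestReg` (bridge).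
* §2 ★★★ `lzdetResidueOnRegL` — the Gaussian half on the class from `P0HolExtAtRecordGL F`, `ClassP2Reg F`, `ClassP5NestReg F`.
* §3 ★★★ `lzHalfReg_of_P0C_of_classP2_of_classP5Nest` — №633's shape.

HONEST FRAMING.  One `obtain` chain over DISPLAYED letters (`P0HolExtAtRecordGL` = `stub_P0C`; `ClassP2Reg`, `ClassP5NestReg` = its class by-products on the same P0C ∕ P0-ℝ critical path;
inhabited NOWHERE) and the tree's own theorems; `stub_LZhalfReg` is a theorem MODULO those three letters, the registry untouched; nothing of Bałaban's RG estimates asserted, ported or discharged;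
⟨27930⟩ OPEN 1∕4 · no claim; ⟨26900⟩ 0∕4; NODE O 0∕1; COUNT 8∕28 · K 1∕4 UNMOVED; finite `𝕋⁴_{L^K}` at fixed ε — NOT continuum ∕ OS; **the Yang–Mills mass gap (Clay) is NOT proved by any of
this.**  No `sorry`, no `def`, no `instance`; standard axioms.
-/

noncomputable section

open scoped BigOperators Matrix.Norms.L2Operator Topology

namespace Summit.QuantumFields.YangMills.Theorems.BalabanUVNodesPortS1

open Summit.QuantumFields.YangMills.Theorems.K0RecordFormatNames
open Literature.MathematicalPhysics.QuantumFieldTheory.Balaban1983to89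
open Literature.MathematicalPhysics.QuantumFieldTheory.Balaban1983to89.Node00
open Literature.MathematicalPhysics.QuantumFieldTheory.Balaban1983to89.T4Continuum (T4Family)
open Literature.MathematicalPhysics.QuantumFieldTheory.Balaban1983to89.B12TreeDecay (K₀ kappa₀)
open _root_.Filter

variable (F : T4Family)

/-! ## §1  The base point: the cut pairs of `W_0` are the unit pair; (t4) consistency; the bridge -/

open scoped Classical in
/-- At `B = 0` every cut pair is the unit pair `(1, 0)` (`U_{k+1}(W_0) = 1`, its current `0`). [cite: Balaban1987RG1, (2.3) p.265, (1.9) p.261 (bookkeeping)] -/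
theorem pairCutTorusAt_zero (a₀ ε₂₉ : ℝ) (Mc k n : ℕ) (X : (recordDomSys F Mc k (recordK₀ F Mc k + n)).Dom) :
    letI θ := thetaFill F a₀ ε₂₉; letI := θ.instVβ₁; letI := θ.instVβ₂; letI := θ.instιβ
    pairCutTorusAt F a₀ ε₂₉ Mc k (recordK₀ F Mc k + n) X (0 : recordW F a₀ ε₂₉ k (recordK₀ F Mc k + n)) = unitCPair F (recordK₀ F Mc k + n) := by
  letI θ := thetaFill F a₀ ε₂₉; letI := θ.instVβ₁; letI := θ.instVβ₂; letI := θ.instιβ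
  have hk := succ_le_m_add_K_recordK₀ F Mc k n
  have hU : recordBgField F θ k (recordK₀ F Mc k + n) (0 : recordW F a₀ ε₂₉ k (recordK₀ F Mc k + n)) = 1 := recordBgField_zero F θ hk
  have hJ : recordCurrent F θ k (recordK₀ F Mc k + n) (0 : recordW F a₀ ε₂₉ k (recordK₀ F Mc k + n)) = 0 := recordCurrent_zero F θ hk
  refine Prod.ext (funext fun b => ?_) (funext fun b => ?_)
  · show (if b ∈ domBonds F Mc k (recordK₀ F Mc k + n) X then
        ((recordBgField F θ k (recordK₀ F Mc k + n) (0 : recordW F a₀ ε₂₉ k (recordK₀ F Mc k + n)) b : SU 2) : MatA 2) else 1) = 1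
    rw [hU]
    split_ifs <;> rfl
  · show (if b ∈ domBonds F Mc k (recordK₀ F Mc k + n) X then
        recordCurrent F θ k (recordK₀ F Mc k + n) (0 : recordW F a₀ ε₂₉ k (recordK₀ F Mc k + n)) b else 0) = 0
    rw [hJ]
    split_ifs <;> rfl

/-- **The base point cuts into every record space**: `CutsInUc … α₀ α₁ … 0` for `α₀, α₁ > 0` (the unit pair lies in every `U^c(X, α₀, α₁)`). [cite: Balaban1987RG1, p.263 L5–13, (1.11)–(1.16) p.262] -/
theorem cutsInUc_zero (a₀ ε₂₉ : ℝ) (Mc k n : ℕ) {α₀ α₁ : ℝ} (hα₀ : 0 < α₀) (hα₁ : 0 < α₁) :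
    letI θ := thetaFill F a₀ ε₂₉; letI := θ.instVβ₁; letI := θ.instVβ₂; letI := θ.instιβ
    CutsInUc F Mc k α₀ α₁ a₀ ε₂₉ n (0 : recordW F a₀ ε₂₉ k (recordK₀ F Mc k + n)) := by
  intro X
  rw [pairCutTorusAt_zero]
  have h := encodeCfg_unitPair_mem_recordUc F Mc k (recordK₀ F Mc k + n) X hα₀ hα₁
  rwa [embedPair_unitPair] at h

/-- ★ **(◆ C34 (t4)) CONSISTENCY AT THE BASE POINT**: for every carrier family with the P0-ℂ body, the BODY of `ClassP5NestReg` at the class point `B = 0` (which lies in every ε₀-class,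
✓`inRegClass_zero`) is a THEOREM with `γ′ := γ₁`: `PosDef T(0) ∧ ⟨v, T(0)v⟩ ≤ γ₁|v|² ∧ CutsInUc … 0` — (P5) of `P0CarrierClauses` read at the base point of its own germ and §1.  So the new letter
and the landed ones agree where both speak; a mis-keyed `γ′` or `α`-order would fail here. [cite: Balaban1987RG1, (2.11)–(2.12) pp.267–268, p.263 L5–13; Balaban1985Variational, Prop. 9 p.309] -/
theorem classP5NestBody_zero_of_P0C {Mc : ℕ} {a₀ δ₀ c₀ γ₀ γ₁ α₀ α₁ ε₂₉ : ℝ} {k : ℕ} (hα₀ : 0 < α₀) (hα₁ : 0 < α₁)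
    {TC : (n : ℕ) → Sect2.CPair (F.P (recordK₀ F Mc k + n)) (MatA 2) → FluctIdx F k (recordK₀ F Mc k + n) → FluctIdx F k (recordK₀ F Mc k + n) → ℂ}
    {TY : (n : ℕ) → (recordDomSys F Mc k (recordK₀ F Mc k + n)).Dom → Sect2.CPair (F.P (recordK₀ F Mc k + n)) (MatA 2) →
        FluctIdx F k (recordK₀ F Mc k + n) → FluctIdx F k (recordK₀ F Mc k + n) → ℂ}
    {TZY : Finset (Fin 4 → ℤ) → IntBondCfg → ((Fin 4 → ℤ) × Fin 4) × Fin 3 → ((Fin 4 → ℤ) × Fin 4) × Fin 3 → ℂ}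
    {AdM : (n : ℕ) → (Site (F.P (recordK₀ F Mc k + n)) 0 → (MatA 2)ˣ) → Matrix (FluctIdx F k (recordK₀ F Mc k + n)) (FluctIdx F k (recordK₀ F Mc k + n)) ℂ}
    {AdZ : ((Fin 4 → ℤ) → (MatA 2)ˣ) → (Fin 4 → ℤ) × Fin 4 → Matrix (Fin 3) (Fin 3) ℂ}
    (hP : P0CarrierClauses F a₀ δ₀ c₀ γ₀ γ₁ Mc α₀ α₁ ε₂₉ k TC TY TZY AdM AdZ) (n : ℕ) :
    letI θ := thetaFill F a₀ ε₂₉; letI := θ.instVβ₁; letI := θ.instVβ₂; letI := θ.instιβ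
    (recordPreckLoc F k (recordK₀ F Mc k + n) a₀ (portVkAx F a₀ ε₂₉ k (recordK₀ F Mc k + n) 0)
        (hopLinGraph F k (recordK₀ F Mc k + n) (portVkAx F a₀ ε₂₉ k (recordK₀ F Mc k + n) 0))).PosDef ∧
    (∀ v : NonB0Idx F k (recordK₀ F Mc k + n) → ℝ,
      dotProduct v (Matrix.mulVec (recordPreckLoc F k (recordK₀ F Mc k + n) a₀ (portVkAx F a₀ ε₂₉ k (recordK₀ F Mc k + n) 0)
          (hopLinGraph F k (recordK₀ F Mc k + n) (portVkAx F a₀ ε₂₉ k (recordK₀ F Mc k + n) 0))) v) ≤ γ₁ * dotProduct v v) ∧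
    CutsInUc F Mc k α₀ α₁ a₀ ε₂₉ n (0 : recordW F a₀ ε₂₉ k (recordK₀ F Mc k + n)) := by
  letI θ := thetaFill F a₀ ε₂₉; letI := θ.instVβ₁; letI := θ.instVβ₂; letI := θ.instιβ
  obtain ⟨-, -, -, -, -, -, -, -, -, -, -, hP5, -⟩ := hP
  have h0 := (hP5 n).self_of_nhds
  exact ⟨h0.1, fun v => (h0.2 v).2, cutsInUc_zero F a₀ ε₂₉ Mc k n hα₀ hα₁⟩

/-- **The bridge to the first-cut nesting letter**: `ClassP5NestReg F → ClassNestsUc F` (its last conjunct). [cite: Balaban1987RG1, p.263 L5–13 (bookkeeping)] -/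
theorem classNestsUc_of_classP5NestReg {F : T4Family} (h : ClassP5NestReg F) : ClassNestsUc F := by
  intro Mc a₀ ε₂₉ α₀ α₁ hG ha₀ hε hα₀ hα₁
  obtain ⟨ε₀, γ', hε₀, -, H⟩ := h Mc a₀ ε₂₉ α₀ α₁ hG ha₀ hε hα₀ hα₁
  exact ⟨ε₀, hε₀, fun k n B hB => (H k n B hB).2.2⟩

/-! ## §2  ★★★ The Gaussian half on the class from `P0HolExtAtRecordGL`, `ClassP2Reg`, `ClassP5NestReg` -/

/-- ★★★ **THE GAUSSIAN HALF `phiLZdet` ON PRINT's ε₀-CLASS FROM THE P0-ℂ LETTER, THE (P2)-CLASS LETTER AND THE CARRIER-FREE CLASS LETTER** — ✓`lzdetResidueOnReg`'s walk with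
`ClassP5NestReg`: the class radius `δcls := min (min ε₂ ε₅) ε_cl` (`ε₂`, `ε₅` the two letters' radii at `(Mc, a₀, ε₂₉, …, α₀, α₁)`, `ε_cl = min (ε₁∕2) (1∕(53581824·L⁶))`), the (63) radius
`R := max (2γ′) (16c₀·64K₀·e^{δ₀})` with the letter's `γ′`. [cite: Balaban1985UV3, (63) p.272, (23)–(25) p.262; Balaban1987RG1, (2.11)–(2.14) pp.267–268, (1.18)–(1.19) p.263, (1.21) p.264,
(1.1)–(1.2) p.260, p.263 L5–13; Balaban1985Variational, Prop. 9 p.309, Thm 1 p.279] -/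
theorem lzdetResidueOnRegL (hP : P0HolExtAtRecordGL F) (hC2 : ClassP2Reg F) (hC5 : ClassP5NestReg F) :
    ∃ Mth : ℕ, ∀ Mc : ℕ, Mth ≤ Mc → McGuard F Mc →
    ∀ (B₃ a₀ a₁ : ℝ), 2 * (F.L : ℝ) ^ 2 ≤ B₃ → 0 < a₀ → 0 < a₁ →
    (∀ ε₁ : ℝ, 0 < ε₁ → ε₁ ≤ a₁ → B₃ * ε₁ ≤ a₀ → ∀ (k n : ℕ) (V : GaugeField (F.P (recordK₀ F Mc k + n)) (k + 1) (SU 2)), PlaqSmall ε₁ V →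
      UkExists F 2 (recordK₀ F Mc k + n) (k + 1) a₀ V ∧ UniqueUkOrbit F 2 (recordK₀ F Mc k + n) (k + 1) a₀ V) →
    ∀ ε₂₉ : ℝ, 0 < ε₂₉ → ∃ E₁ κ α₀ α₁ δ₀ : ℝ, 0 ≤ E₁ ∧ 4 * kappa₀ (4 * 2 ^ 4) (2 * 4) ≤ κ ∧ 0 < α₀ ∧ 0 < α₁ ∧ 0 < δ₀ ∧
      ∀ k : ℕ, ∃ (Ψ : IntLocalFormula (F.L ^ (k + 1) * Mc)) (Ew : TorusPieces F Mc k),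
        Ψ.ResidueOnRegAtW F Mc k Ew a₀ ε₂₉ α₀ α₁ δ₀ E₁ κ (phiLZdet F Mc a₀ ε₂₉ k) := by
  obtain ⟨c₀, γ₀, γ₁, δ₁, hc₀, hγ₀, hγ, hδ₁, HP⟩ := hP
  have hκ₈0 : 0 ≤ kappa₀ (4 * 2 ^ 4) (2 * 4) := B12TreeDecay.kappa₀_nonneg (by norm_num) _
  have hκt0 : 0 < 4 * kappa₀ (4 * 2 ^ 4) (2 * 4) + 2 := by positivity
  obtain ⟨δG, hδG, Mth', HG⟩ := g3cPiecesAt_pointwise F (4 * kappa₀ (4 * 2 ^ 4) (2 * 4) + 2) hκt0 c₀ γ₀ γ₁ δ₁ hc₀ hγ₀ hγ hδ₁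
  obtain ⟨δ₀, hδ₀G, hδ₀8⟩ : ∃ δ₀ : ℝ, δG ≤ δ₀ ∧ 8 * kappa₀ (4 * 2 ^ 4) (2 * 4) + 4 ≤ δ₀ := ⟨max δG _, le_max_left _ _, le_max_right _ _⟩
  have hδ₀pos : 0 < δ₀ := hδG.trans_le hδ₀G
  obtain ⟨Mth, HM⟩ := HP δ₀ hδ₀pos
  refine ⟨max Mth Mth', fun Mc hMc hGuard B₃ a₀ a₁ hB₃ ha₀ ha₁ hUk ε₂₉ hε => ?_⟩
  obtain ⟨Bc, hBc, HB⟩ := HG δ₀ hδ₀G Mc ((le_max_right _ _).trans hMc) hGuard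
  have hB₃pos : 0 < B₃ := by
    have hL : (1 : ℝ) ≤ F.L := by exact_mod_cast F.hL.2.le
    nlinarith
  set ε₁ : ℝ := min a₁ (a₀ / B₃) with hε₁def
  have hε₁ : 0 < ε₁ := lt_min ha₁ (div_pos ha₀ hB₃pos)
  have hTokE := hUk ε₁ hε₁ (min_le_left _ _) (by
    calc B₃ * min a₁ (a₀ / B₃) ≤ B₃ * (a₀ / B₃) := mul_le_mul_of_nonneg_left (min_le_right _ _) hB₃pos.le
      _ = a₀ := by field_simp)
  obtain ⟨α₀, α₁, hα₀, hα₁, HK⟩ := HM Mc ((le_max_left _ _).trans hMc) hGuard a₀ ha₀ ⟨_, hε₁, hTokE⟩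
  -- the two class radii, the letter's form constant, the twins' radius
  obtain ⟨ε₂, hε₂, HC2⟩ := hC2 Mc a₀ ε₂₉ δ₀ c₀ γ₀ γ₁ α₀ α₁ hGuard ha₀ hε
  obtain ⟨ε₅, γ', hε₅, hγ', HC5⟩ := hC5 Mc a₀ ε₂₉ α₀ α₁ hGuard ha₀ hε hα₀ hα₁
  set εcl : ℝ := min (ε₁ / 2) (1 / (53581824 * (F.L : ℝ) ^ 6)) with hεcldef
  have hLpos : (0 : ℝ) < F.L := by exact_mod_cast F.hL.2.le.trans_lt' (by norm_num)
  have hεcl : 0 < εcl := lt_min (half_pos hε₁) (by positivity)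
  set δcls : ℝ := min (min ε₂ ε₅) εcl with hδclsdef
  have hδcls : 0 < δcls := lt_min (lt_min hε₂ hε₅) hεcl
  have hδ2 : δcls ≤ ε₂ := (min_le_left _ _).trans (min_le_left _ _)
  have hδ5 : δcls ≤ ε₅ := (min_le_left _ _).trans (min_le_right _ _)
  have hδcl : δcls ≤ εcl := min_le_right _ _
  have hδclsc : δcls ≤ 1 / (53581824 * (F.L : ℝ) ^ 6) := hδcl.trans (min_le_right _ _)
  have hδclsε : 2 * δcls ≤ ε₁ := by have := hδcl.trans (min_le_left _ _); linarith
  -- the radius of [16] (63), with the letter's form constant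
  obtain ⟨R, hR₁, hRc⟩ : ∃ R : ℝ, 2 * γ' ≤ R ∧ 2 * ((2 * c₀) * (4 * 2 ^ 4 * K₀ (4 * 2 ^ 4) (2 * 4)) * Real.exp δ₀) ≤ R :=
    ⟨max _ _, le_max_left _ _, le_max_right _ _⟩
  have hR : 0 < R := lt_of_lt_of_le (by positivity) hR₁
  refine ⟨2 * (13 * 4 ^ 4 * (R * Bc + ((3 * 4 * (F.L * Mc) ^ 4 : ℕ) : ℝ))), min (4 * kappa₀ (4 * 2 ^ 4) (2 * 4) + 2) (δ₀ / 2) - 2, α₀, α₁, δcls,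
    by positivity, ?_, hα₀, hα₁, hδcls, fun k => ?_⟩
  · have h2 : 4 * kappa₀ (4 * 2 ^ 4) (2 * 4) + 2 ≤ δ₀ / 2 := by
      set κ₈ := kappa₀ (4 * 2 ^ 4) (2 * 4) with hκ₈
      linarith
    have h3 : 4 * kappa₀ (4 * 2 ^ 4) (2 * 4) + 2 ≤ min (4 * kappa₀ (4 * 2 ^ 4) (2 * 4) + 2) (δ₀ / 2) := le_min le_rfl h2
    set κ₈ := kappa₀ (4 * 2 ^ 4) (2 * 4) with hκ₈
    set m := min (4 * κ₈ + 2) (δ₀ / 2) with hm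
    linarith
  · obtain ⟨TC, TY, TZY, AdM, AdZ, hPC, hLat⟩ := HK ε₂₉ hε k
    obtain ⟨EG, EGZ, hG3, hg1pt⟩ := HB a₀ α₀ α₁ ε₂₉ ha₀ hα₀ hα₁ hε k TC TY TZY AdM AdZ hPC hLat
    obtain ⟨ΨP, hΨP⟩ := stub_LZdetTwin F Mc hGuard a₀ δ₀ c₀ γ₀ γ₁ α₀ α₁ ε₂₉ k TC TY TZY AdM AdZ hPC R
    have hδ : kappa₀ (4 * 2 ^ 4) (2 * 4) ≤ δ₀ / 2 - 1 := by
      set κ₈ := kappa₀ (4 * 2 ^ 4) (2 * 4) with hκ₈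
      linarith
    exact lzdetResidueOnReg_of_carriers_classP5Nest F hGuard k ha₀ hα₀ hα₁ hc₀ hγ' hBc hR hR₁ hδ hRc hδcls hδclsc hδclsε (hTokE k)
      TC TY TZY AdM AdZ hPC EG EGZ hG3 hg1pt ΨP hΨP
      (fun n B hB => HC2 k TC TY TZY AdM AdZ hPC n B (inRegClass_mono hδ2 hB))
      (fun n B hB => ⟨(HC5 k n B (inRegClass_mono hδ5 hB)).1, (HC5 k n B (inRegClass_mono hδ5 hB)).2.1⟩)
      (fun n B hB => (HC5 k n B (inRegClass_mono hδ5 hB)).2.2)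

/-! ## §3  ★★★ The brick in №633's shape -/

/-- ★★★ **`lzHalfReg_of_P0C_of_classP2_of_classP5Nest`** (★★★ director-ym №633's shape): `(∀F, P0HolExtAtRecordGL F) → (∀F, ClassP2Reg F) → (∀F, ClassP5NestReg F) → ∀F, PortRecordLZHalfReg F` —
v3.7's `stub_LZhalfReg` type from `stub_P0C`'s letter, the (P2)-class letter and the ONE carrier-free class letter ((2.11) positivity + p.263 nesting on U_k(ε₀)); the δ-Jacobian half UNCONDITIONAL
(✓`lzjacResidueOnReg`), the Gaussian half by §2; `phiLZ = phiLZjac + phiLZdet`; radii, rates, class radii by `min`, constants added.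
[cite: Balaban1987RG1, (1.4) p.260, (1.6)–(1.7) p.261, (1.18)–(1.19) p.263, (1.21) p.264, (2.11)–(2.12) pp.267–268, (1.1)–(1.2) p.260, p.263 L5–13; Balaban1985UV3, (63) p.272;
Balaban1985Variational, Thm 1 p.279, Prop. 9 p.309] -/
theorem lzHalfReg_of_P0C_of_classP2_of_classP5Nest (hP : ∀ F, P0HolExtAtRecordGL F) (hC2 : ∀ F, ClassP2Reg F) (hC5 : ∀ F, ClassP5NestReg F) :
    ∀ F, PortRecordLZHalfReg F := by
  intro F
  obtain ⟨M₁, H₁⟩ := lzjacResidueOnReg F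
  obtain ⟨M₂, H₂⟩ := lzdetResidueOnRegL F (hP F) (hC2 F) (hC5 F)
  refine ⟨max M₁ M₂, fun Mc hMc j c cc₀ c₁ B₃ B₃' a₀ a₁ hGuard _ _ _ hB₃ _ ha₀ ha₁ _ _ hUk _ _ ε₂₉ hε => ?_⟩
  obtain ⟨E₁, κ₁, α₀, α₁, δ₁, hE₁, hκ₁, hα₀, hα₁, hδ₁, HJ⟩ := H₁ Mc (le_of_max_le_left hMc) hGuard B₃ a₀ a₁ hB₃ ha₀ ha₁ hUk ε₂₉
  obtain ⟨E₂, κ₂, β₀, β₁, δ₂, hE₂, hκ₂, hβ₀, hβ₁, hδ₂, HD⟩ := H₂ Mc (le_of_max_le_right hMc) hGuard B₃ a₀ a₁ hB₃ ha₀ ha₁ hUk ε₂₉ hε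
  refine ⟨E₁ + E₂, min κ₁ κ₂, min α₀ β₀, min α₁ β₁, min δ₁ δ₂, add_nonneg hE₁ hE₂, le_min hκ₁ hκ₂, lt_min hα₀ hβ₀, lt_min hα₁ hβ₁, lt_min hδ₁ hδ₂, fun k => ?_⟩
  obtain ⟨Ψ₁, Ew₁, hR₁⟩ := HJ k
  obtain ⟨Ψ₂, Ew₂, hR₂⟩ := HD k
  have h := residueOnRegAtW_add F Ψ₁ Ψ₂ Ew₁ Ew₂ a₀ ε₂₉ (min α₀ β₀) (min α₁ β₁) (min δ₁ δ₂) E₁ E₂ (min κ₁ κ₂) (phiLZjac F Mc a₀ ε₂₉ k) (phiLZdet F Mc a₀ ε₂₉ k)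
    (residueOnRegAtW_anti_eps (residueOnRegAtW_anti_radii (residueOnRegAtW_mono hR₁ le_rfl (min_le_left _ _) hE₁) (min_le_left _ _) (min_le_left _ _)) (min_le_left _ _))
    (residueOnRegAtW_anti_eps (residueOnRegAtW_anti_radii (residueOnRegAtW_mono hR₂ le_rfl (min_le_right _ _) hE₂) (min_le_right _ _) (min_le_right _ _)) (min_le_right _ _))
  refine ⟨Ψ₁.add Ψ₂, fun n X φ => Ew₁ n X φ + Ew₂ n X φ, h.1, h.2.1, h.2.2.1, h.2.2.2.1, h.2.2.2.2.1, h.2.2.2.2.2.1, ?_⟩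
  exact representsOnRegW_congr F _ _ a₀ ε₂₉ (min δ₁ δ₂) (phiLZ F Mc a₀ ε₂₉ k) (fun n B => phiLZjac F Mc a₀ ε₂₉ k n B + phiLZdet F Mc a₀ ε₂₉ k n B)
    (fun n B => phiLZjac_add_phiLZdet F Mc a₀ ε₂₉ k n B) h.2.2.2.2.2.2

end Summit.QuantumFields.YangMills.Theorems.BalabanUVNodesPortS1

end
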